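import Mathlib
import HarnessLib
import Literature.AlgebraicGeometry.Resolution.BlowupsFlatBaseChange
import Literature.AlgebraicGeometry.Resolution.FundamentalLocus
import Literature.AlgebraicGeometry.Resolution.RationalSurfaceSingularitiesBasic
import Literature.AlgebraicGeometry.Resolution.QuasiProjectiveResolution
import Literature.AlgebraicGeometry.Resolution.PrincipalizationToResolution
import Literature.AlgebraicGeometry.Morphisms.CechH1AffineProofs
import Literature.AlgebraicGeometry.Motives.GoodReductionSpecialFibreProofs
import Summits.ResolutionOfSingularities.ResolutionOfSingularities.Theorems.DescentDescentPerfectToAllRobustModel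
import Summits.ResolutionOfSingularities.ResolutionOfSingularities.Theorems.HomologicalConductorNoZenoStageRational

/-!
# Kill test `SurfaceTermination` (stmt-ResolutionOfSingularities-16488), W4.4 support programme
# «P_G LERAY» (U2c, part 1): the base change of a proper birational morphism of regular surfaces
# to the local scheme of a point is a resolution with trivial `Ȟ¹`

Route `ResolutionOfSingularities/HomologicalConductor`, crux chain W4.4; SUPPORT-level (kill test
`SurfaceTermination`, CHAIN v13), NOT crux 19943. OURS (cell res-hironaka; res-D-pv-045, PG-LERAY-NOTE
block (L3) «independence of `p_g` under domination», tri-1 TRIAGE v6.2 (5a)); AI-written, weaker than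
expert review; nothing of the manuscript under review (Hironaka 2017) is used.

For `ρ : Z → X` proper birational with `Z` regular, `X` integral, and a point `x ∈ X`:
* `isResolution_pullback_snd_fromSpecStalk` — `Z ×_X Spec 𝒪_{X,x} → Spec 𝒪_{X,x}` is a resolution
  (proper; birational by flat base change, `isBirational_of_isPullback_of_flat` + `flat_fromSpecStalk`;
  regular source, the projection to `Z` being a flat preimmersion, `BlowupsFlatBaseChange`), and its
  source is integral;
* `hasTrivialCechH1_pullback_snd_fromSpecStalk` — if moreover `X` is regular at `x` with
  `dim 𝒪_{X,x} ≤ 2`, then `Ȟ¹ = 0` on the base change: for `dim = 2` by Lipman 1969 (1.2) 2) (named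
  fact `Lipman1969_1_2`; a regular two-dimensional local ring has a rational singularity), for `dim ≤ 1`
  because `𝒪_{X,x}` is a field or a DVR, over which a proper birational morphism from an integral scheme
  is an isomorphism (tree `FundamentalLocus`), so the base change is affine (Görtz–Wedhorn II 22.1,
  tree `cechH1_affine_vanishing_holds`).
This is «`R¹ρ_*𝒪_Z = 0` stalkwise over a regular surface», the pointwise input of the resolution
independence of the geometric genus.

References: J. Lipman, Publ. IHÉS 36 (1969), Prop. (1.2) [`Lipman1969`]; O. Piltant, RACSAM 107 (2013) §2
[`Piltant2013`]; M. Temkin, Adv. Math. 219 (2008) §2.1 [`Temkin2008`]; Görtz–Wedhorn II Lemma 22.1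
[`GortzWedhorn2023`].
-/

noncomputable section
set_option linter.dupNamespace false

namespace Summit.ResolutionOfSingularities.ResolutionOfSingularities.Theorems.SurfaceTermination.GenusDescent

open CategoryTheory CategoryTheory.Limits AlgebraicGeometry TopologicalSpace IsLocalRing
open Literature.AlgebraicGeometry.Resolution Literature.AlgebraicGeometry.Morphisms
open Summit.ResolutionOfSingularities.ResolutionOfSingularities.Theorems
open Summit.ResolutionOfSingularities.ResolutionOfSingularities.Theorems.NoZeno.SandwichCluster

variable {X Z : Scheme.{0}} [IsIntegral X] [NoetherianSpace X] [NoetherianSpace Z]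
  (ρ : Z ⟶ X) [IsProper ρ] (x : X)

/-- **The base change `Z ×_X Spec 𝒪_{X,x} → Spec 𝒪_{X,x}` of a proper birational `ρ : Z → X` with `Z`
regular is a resolution of `Spec 𝒪_{X,x}`, with integral source.** [cite: Temkin2008, §2.1 (p. 6)] -/
theorem isResolution_pullback_snd_fromSpecStalk (hρ : IsBirational ρ) (hZ : Scheme.IsRegular Z) :
    IsResolution (pullback.snd ρ (X.fromSpecStalk x)) ∧ IsIntegral (pullback ρ (X.fromSpecStalk x)) := by
  haveI := flat_fromSpecStalk X x
  have sq := IsPullback.of_hasPullback ρ (X.fromSpecStalk x)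
  -- birational, by flat base change
  have hbir : IsBirational (pullback.snd ρ (X.fromSpecStalk x)) :=
    isBirational_of_isPullback_of_flat sq hρ
  -- regular source: the projection to `Z` is a flat preimmersion
  have hreg : Scheme.IsRegular (pullback ρ (X.fromSpecStalk x)) := fun s =>
    (Scheme.mem_regularLocus s).mp
      ((mem_regularLocus_iff_pullback_fst_fromSpecStalk ρ x s).mpr
        ((Scheme.mem_regularLocus _).mpr (hZ _)))
  -- integral source: irreducible (birational onto the irreducible `Spec 𝒪_{X,x}`) and reduced (regular)
  haveI : IrreducibleSpace ↥(pullback ρ (X.fromSpecStalk x)) := hbir.irreducibleSpace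
  haveI : IsReduced (pullback ρ (X.fromSpecStalk x)) := hreg.isReduced
  exact ⟨⟨inferInstance, hbir, hreg⟩, isIntegral_of_irreducibleSpace_of_isReduced _⟩

/-- A proper birational morphism from an integral scheme onto the spectrum of a Noetherian normal LOCAL
domain of dimension `≤ 1` (a field or a DVR) is an isomorphism (tree `FundamentalLocus`: isomorphism over
a neighbourhood of the closed point, which is everything). [cite: Piltant2013, §2, remark after Axiom 2] -/
theorem isIso_of_isBirational_of_ringKrullDim_le_one (R : Type) [CommRing R] [IsDomain R]
    [IsNoetherianRing R] [IsLocalRing R] [IsIntegrallyClosed R] (hdim : ringKrullDim R ≤ 1)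
    {W : Scheme.{0}} [IsIntegral W] (g : W ⟶ Spec (.of R)) [IsProper g] (hg : IsBirational g) :
    IsIso g := by
  haveI : IsIntegral (Spec (.of R)) := inferInstance
  -- the stalk at the closed point is `R` itself
  have hdim' : ringKrullDim ((Spec (.of R)).presheaf.stalk (closedPoint R)) ≤ 1 := by
    letI : Algebra R ((Spec (.of R)).presheaf.stalk (closedPoint R)) :=
      StructureSheaf.stalkAlgebra R (closedPoint R)
    haveI : IsLocalization.AtPrime ((Spec (.of R)).presheaf.stalk (closedPoint R))
        (maximalIdeal R) := StructureSheaf.IsLocalization.to_stalk R (closedPoint R)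
    have e : R ≃+* (Spec (.of R)).presheaf.stalk (closedPoint R) :=
      (IsLocalization.atUnits R (maximalIdeal R).primeCompl (fun s hs => by
        by_contra h
        exact hs ((IsLocalRing.mem_maximalIdeal _).mpr (mem_nonunits_iff.mpr h)))).toRingEquiv
    rwa [← ringKrullDim_eq_of_ringEquiv e]
  obtain ⟨V, hV, hiso⟩ := exists_isIso_morphismRestrict_of_ringKrullDim_le_one g hg ⊤
    (fun y _ => Literature.AlgebraicGeometry.Motives.isIntegrallyClosed_stalk_Spec (.of R) y)
    (Set.mem_univ _) hdim'
  -- an open of the local scheme containing the closed point is everything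
  have hV' : V = ⊤ := (IsLocalRing.closedPoint_mem_iff V).mp hV
  subst hV'
  haveI := hiso
  -- `g ∣_ ⊤` is `g` up to the isomorphisms `⊤ ≅ W`, `⊤ ≅ Spec R`
  have h2 : (g ⁻¹ᵁ (⊤ : (Spec (.of R)).Opens)).ι ≫ g = (g ∣_ ⊤) ≫ (⊤ : (Spec (.of R)).Opens).ι :=
    (morphismRestrict_ι g ⊤).symm
  haveI : IsIso (⊤ : (Spec (.of R)).Opens).ι := by
    rw [← Scheme.topIso_hom]; infer_instance
  haveI : IsIso (g ⁻¹ᵁ (⊤ : (Spec (.of R)).Opens)).ι := by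
    rw [show g ⁻¹ᵁ (⊤ : (Spec (.of R)).Opens) = ⊤ from rfl, ← Scheme.topIso_hom]; infer_instance
  haveI : IsIso ((g ⁻¹ᵁ (⊤ : (Spec (.of R)).Opens)).ι ≫ g) := by rw [h2]; infer_instance
  exact IsIso.of_isIso_comp_left (g ⁻¹ᵁ (⊤ : (Spec (.of R)).Opens)).ι g

set_option maxHeartbeats 400000 in
/-- **`Ȟ¹ = 0` on the base change of a proper birational `ρ : Z → X` (`Z` regular) to `Spec 𝒪_{X,x}` at a
REGULAR point `x` of dimension `≤ 2`** — for `dim 𝒪_{X,x} = 2` by Lipman (1.2) 2) (the regular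
`𝒪_{X,x}` has a rational singularity), for `dim ≤ 1` because the base change is then an isomorphism onto
`Spec 𝒪_{X,x}` (affine, Čech `H¹` vanishes). [cite: Lipman1969, Proposition (1.2) 2) (p. 199)] -/
theorem hasTrivialCechH1_pullback_snd_fromSpecStalk (h12 : Lipman1969_1_2.{0}) (hρ : IsBirational ρ)
    (hZ : Scheme.IsRegular Z) (hx : IsRegularLocalRing (X.presheaf.stalk x))
    (hdim : ringKrullDim (X.presheaf.stalk x) ≤ 2) :
    HasTrivialCechH1 (pullback.snd ρ (X.fromSpecStalk x)) := by
  obtain ⟨hres, hint⟩ := isResolution_pullback_snd_fromSpecStalk ρ x hρ hZ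
  haveI := hx
  haveI := hint
  haveI : IsIntegrallyClosed (X.presheaf.stalk x) := isIntegrallyClosed_of_isRegularLocalRing _
  by_cases h2 : ringKrullDim (X.presheaf.stalk x) = 2
  · -- dimension two: Lipman (1.2) 2) at the rational (regular) point
    exact h12.hasTrivialCechH1_of_isResolution h2 (hasRationalSingularity_of_isRegularLocalRing _) _ hres
  · -- dimension `≤ 1`: the base change is an isomorphism, hence affine
    have h1 : ringKrullDim (X.presheaf.stalk x) ≤ 1 := by
      have hb := ringKrullDim_ne_bot (R := X.presheaf.stalk x)
      have ht := ringKrullDim_ne_top (R := X.presheaf.stalk x)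
      obtain ⟨m, hm⟩ := WithBot.ne_bot_iff_exists.mp hb
      rw [← hm] at hdim h2 ht ⊢
      have hmt : m ≠ ⊤ := fun h => ht (by rw [h]; rfl)
      obtain ⟨n, hn⟩ := ENat.ne_top_iff_exists.mp hmt
      rw [← hn] at hdim h2 ⊢
      have hle' : (n : ℕ∞) ≤ 2 := by
        rw [show (2 : WithBot ℕ∞) = ((2 : ℕ∞) : WithBot ℕ∞) from rfl] at hdim
        exact WithBot.coe_le_coe.mp hdim
      have hle : n ≤ 2 := by
        rw [show (2 : ℕ∞) = ((2 : ℕ) : ℕ∞) from rfl] at hle'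
        exact ENat.coe_le_coe.mp hle'
      have hne : n ≠ 2 := fun h => h2 (by rw [h]; rfl)
      have h1' : (n : ℕ∞) ≤ 1 := by
        rw [show (1 : ℕ∞) = ((1 : ℕ) : ℕ∞) from rfl]
        exact ENat.coe_le_coe.mpr (by omega)
      rw [show (1 : WithBot ℕ∞) = ((1 : ℕ∞) : WithBot ℕ∞) from rfl]
      exact WithBot.coe_le_coe.mpr h1'
    haveI := hres.isProper
    haveI := isIso_of_isBirational_of_ringKrullDim_le_one (X.presheaf.stalk x) h1
      (pullback.snd ρ (X.fromSpecStalk x)) hres.isBirational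
    haveI : IsAffine (pullback ρ (X.fromSpecStalk x)) :=
      IsAffine.of_isIso (pullback.snd ρ (X.fromSpecStalk x))
    intro ι _ U hU hcov
    refine ⟨fun a b => ?_⟩
    obtain ⟨za, rfl⟩ := CechH1.mk_surjective _ U a
    obtain ⟨zb, rfl⟩ := CechH1.mk_surjective _ U b
    have hv := cechH1_affine_vanishing_holds (pullback.snd ρ (X.fromSpecStalk x))
      (isAffineOpen_top _) U hcov
    rw [(CechH1.mk_eq_zero_iff _ U za).mpr (hv za.2), (CechH1.mk_eq_zero_iff _ U zb).mpr (hv zb.2)]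

end Summit.ResolutionOfSingularities.ResolutionOfSingularities.Theorems.SurfaceTermination.GenusDescent

end
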